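import Summits.BirchSwinnertonDyer.BirchSwinnertonDyer.Theorems.CMKolyvaginAtInertTwoCertificateOneBitBSDTwoOfPrintedInputs
import Summits.BirchSwinnertonDyer.BirchSwinnertonDyer.Theorems.CMKolyvaginAtInertTwoStarDoorOneBitBSDTwoOfPrintedInputs
import HarnessLib

/-! Scratch (bsd-line-cmk2-p1 g22): TURNKEY for the PRINT route's pen (bsd-print-cf2-plan, route PrintCf2) — two bookable H₂ class
asides MODULO PRINT, widening the booked level-zero aside `PrintCf2.InertTwoLevelZeroPrimeHeegnerOfFactsPlus` (28275, rule (c)) and the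
booked (★)-door `PrintCf2.InertKrizLiStarDoorOfFactsPlus` (21366):

(A) `InertTwoCertificateOneBitHeegnerOfFactsPlus` — CERTIFICATE LEVEL: same six prints, `W ∈ H₂`, a Heegner field of ONE-BIT genus
    defect `Σ ≤ 1`, an optimal odd-Manin frame, `y_K = P(1)` of infinite order and ANY `2`-primitive Kolyvagin class `P(n) ∉ 2E(K[n])`
    (`n` square-free of CM-inert Zhang–Kolyvagin primes at `2`) ⟹ `BSDp W 2`.  (28275 = the case `n = 1`, prime `|d_K|`.)
    Closer: `KolyvaginLowerTwo.bsdp_two_of_exists_certificate_of_sum_defect_le_one_of_printedInputs` (p762853).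
(B)/(B′) `InertTwoStarDoorOneBitOfFactsPlus[′]` — THE CONDUCTOR-FREE (★)-DOOR ON H₂ ((B′) = without the `c₂` clause, PREFERRED; p764018): same six prints, `W ∈ H₂` with `c₂(W)` odd, SOME one-bit
    Heegner field `K`, optimal odd-Manin frame `(Dt, β, ι, d₁)`, `P₀ ∈ E(K)` under `P(1)` and `j : K → ℚ₂` with Kriz–Li's Assumption (★)
    (`KrizLi2019.AssumptionStar W Dt K P₀ j`) ⟹ `BSDp W 2`.  No Kriz–Li THEOREM and no conductor bound (21366 needs a base of conductor
    `< 5000` + Miller–Stoll + KL Thms 4.3/5.1): the base's BSD₂ is derived by the line's level-zero `2`-converse from (★), whose first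
    step (Kriz–Li Lemma 5.4: (★) ⟹ `P ∉ 2E(K) + tors`) is now PROVED (`KrizLi2019.not_exists_two_nsmul_add_torsion_of_assumptionStar`,
    p763346).  Closer: `KolyvaginLowerTwo.bsdp_two_of_exists_assumptionStar_oneBit_of_printedInputs`.
Both closers kernel-checked below.  Nothing is filed here; BSD is not proved by any of this. -/

namespace Scratch.PrintCf2CertificateAndStarDoor

open scoped Classical

open Summit.BirchSwinnertonDyer.BirchSwinnertonDyer.Theorems

/-- PROPOSED aside (A) `InertTwoCertificateOneBitHeegnerOfFactsPlus` for route PrintCf2. -/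
def InertTwoCertificateOneBitHeegnerOfFactsPlus : Prop :=
  Literature.NumberTheory.EllipticCurves.ModularForms.exists_isNewformOf → (∀ (N : ℕ) [NeZero N] (W : WeierstrassCurve ℚ) (K : Type) [Field K] [NumberField K], Literature.NumberTheory.EllipticCurves.gross_zagier N W K) → Literature.NumberTheory.EllipticCurves.rank_eq_analyticRank_of_analyticRank_le_one → Literature.NumberTheory.EllipticCurves.Milne1972.bsdQuotient_baseChange_quadratic_anyModel → Literature.NumberTheory.EllipticCurves.bsdTriple_of_hasCM_of_L_one_ne_zero → ∀ (W : WeierstrassCurve ℚ) [W.IsElliptic] [W.IsGloballyMinimal] [NeZero (W.conductorNorm ℤ)], W.HasCM → Literature.NumberTheory.EllipticCurves.Rank1Residual.CMInert W 2 → W.HasSurjectiveModNGaloisRep (2 : ℤ) → W.analyticRank = 1 → Odd W.tamagawaProduct → ∀ (K : Type) [Field K] [NumberField K], Literature.NumberTheory.EllipticCurves.IsImaginaryQuadratic K → Odd (NumberField.discr K) → NumberField.discr K ≠ -3 → Literature.NumberTheory.EllipticCurves.SatisfiesHeegnerHypothesis (W.conductorNorm ℤ) K → (∑ q ∈ (NumberField.discr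 K).natAbs.primeFactors, ((if jacobiSym W.Δ.num q = -1 then 1 else 0) + (if jacobiSym W.Δ.num q = 1 ∧ Even (W.frobeniusTrace q) then 2 else 0)) ≤ 1) → Literature.NumberTheory.EllipticCurves.GrossLMS1991.prop37_2_reductionCongruence_inert (W.conductorNorm ℤ) W K → ∀ (Dt : Literature.NumberTheory.EllipticCurves.ModularForms.ModularParametrizationData W (W.conductorNorm ℤ)), (∀ z ∈ Dt.L.lattice, ∃ w ∈ Literature.NumberTheory.EllipticCurves.ModularForms.periodLattice Dt.f, z = (Dt.c : ℂ) * w) → Odd Dt.c → ∀ (β : ℤ) (ι : K →+* ℂ) (d₁ : Literature.NumberTheory.EllipticCurves.KolyvaginHeegnerData Dt β ι 1), ¬ IsOfFinAddOrder d₁.derivedPoint → (∃ (n : ℕ) (d : Literature.NumberTheory.EllipticCurves.KolyvaginHeegnerData Dt β ι n), Squarefree n ∧ (∀ ℓ ∈ n.primeFactors, Literature.NumberTheory.EllipticCurves.Zhang2014.IsKolyvaginPrime (W.conductorNorm ℤ) W K 2 ℓ ∧ Literature.NumberTheory.EllipticCurves.Rank1Residual.CMInert W ℓ) ∧ ¬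 ∃ Q : (W.baseChange (Literature.NumberTheory.EllipticCurves.ringClassField K ι n)).toAffine.Point, (2 : ℤ) • Q = d.derivedPoint) → Literature.NumberTheory.EllipticCurves.BSDp W 2

/-- THE CLOSER of (A), one line (p762853). -/
theorem inertTwoCertificateOneBitHeegnerOfFactsPlus_proof : InertTwoCertificateOneBitHeegnerOfFactsPlus := by
  intro hmod hGZall hGZK hMilne hBF W _ _ _ hCM hin hsurj hr hT K _ _ hK hodd h3 hH hdef h372 Dt hopt hc β ι d₁ hy hcert
  exact KolyvaginLowerTwo.bsdp_two_of_exists_certificate_of_sum_defect_le_one_of_printedInputs hGZall hGZK hmod hMilne hBF W hCM hin hsurj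
    hr hT K hK hodd h3 hH hdef h372 Dt hopt hc β ι d₁ hy hcert

/-- PROPOSED aside (B) `InertTwoStarDoorOneBitOfFactsPlus` for route PrintCf2 (the conductor-free (★)-door on H₂). -/
def InertTwoStarDoorOneBitOfFactsPlus : Prop :=
  Literature.NumberTheory.EllipticCurves.ModularForms.exists_isNewformOf → (∀ (N : ℕ) [NeZero N] (W : WeierstrassCurve ℚ) (K : Type) [Field K] [NumberField K], Literature.NumberTheory.EllipticCurves.gross_zagier N W K) → Literature.NumberTheory.EllipticCurves.rank_eq_analyticRank_of_analyticRank_le_one → Literature.NumberTheory.EllipticCurves.Milne1972.bsdQuotient_baseChange_quadratic_anyModel → Literature.NumberTheory.EllipticCurves.bsdTriple_of_hasCM_of_L_one_ne_zero → ∀ (W : WeierstrassCurve ℚ) [W.IsElliptic] [W.IsGloballyMinimal] [NeZero (W.conductorNorm ℤ)], W.HasCM → Literature.NumberTheory.EllipticCurves.Rank1Residual.CMInert W 2 → W.HasSurjectiveModNGaloisRep (2 : ℤ) → W.analyticRank = 1 → Odd W.tamagawaProduct → (haveI : Fact (Nat.Prime 2) := ⟨Nat.prime_two⟩; Odd ((W.baseChange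 ℚ_[2]).localTamagawaNumber ℤ_[2])) → (∃ (K : Type) (_ : Field K) (_ : NumberField K), Literature.NumberTheory.EllipticCurves.IsImaginaryQuadratic K ∧ Odd (NumberField.discr K) ∧ NumberField.discr K ≠ -3 ∧ Literature.NumberTheory.EllipticCurves.SatisfiesHeegnerHypothesis (W.conductorNorm ℤ) K ∧ (∑ q ∈ (NumberField.discr K).natAbs.primeFactors, ((if jacobiSym W.Δ.num q = -1 then 1 else 0) + (if jacobiSym W.Δ.num q = 1 ∧ Even (W.frobeniusTrace q) then 2 else 0)) ≤ 1) ∧ Literature.NumberTheory.EllipticCurves.GrossLMS1991.prop37_2_reductionCongruence_inert (W.conductorNorm ℤ) W K ∧ ∃ (Dt : Literature.NumberTheory.EllipticCurves.ModularForms.ModularParametrizationData W (W.conductorNorm ℤ)) (β : ℤ) (ι : K →+* ℂ) (d₁ : Literature.NumberTheory.EllipticCurves.KolyvaginHeegnerData Dt β ι 1) (P₀ : (W.baseChange K).toAffine.Point) (j : K →ₐ[ℚ] ℚ_[2]), (∀ z ∈ Dt.L.lattice, ∃ w ∈ Literature.NumberTheory.EllipticCurves.ModularForms.periodLattice Dt.f,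 z = (Dt.c : ℂ) * w) ∧ Odd Dt.c ∧ WeierstrassCurve.Affine.Point.map (W' := W) (algebraMap K (Literature.NumberTheory.EllipticCurves.ringClassField K ι 1)).toRatAlgHom P₀ = d₁.derivedPoint ∧ Literature.NumberTheory.EllipticCurves.KrizLi2019.AssumptionStar W Dt K P₀ j) → Literature.NumberTheory.EllipticCurves.BSDp W 2

/-- THE CLOSER of (B), one line. -/
theorem inertTwoStarDoorOneBitOfFactsPlus_proof : InertTwoStarDoorOneBitOfFactsPlus := by
  intro hmod hGZall hGZK hMilne hBF W _ _ _ hCM hin hsurj hr hT hc2 hpack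
  exact KolyvaginLowerTwo.bsdp_two_of_exists_assumptionStar_oneBit_of_printedInputs hGZall hGZK hmod hMilne hBF W hCM hin hsurj hr hT hc2
    hpack

/-- PROPOSED aside (B′) `InertTwoStarDoorOneBitOfFactsPlus'` — (B) WITHOUT the `c₂(W)` clause (odd `c₂` follows from the odd Tamagawa product; p764018). PREFERRED. -/
def InertTwoStarDoorOneBitOfFactsPlus' : Prop :=
  Literature.NumberTheory.EllipticCurves.ModularForms.exists_isNewformOf → (∀ (N : ℕ) [NeZero N] (W : WeierstrassCurve ℚ) (K : Type) [Field K] [NumberField K], Literature.NumberTheory.EllipticCurves.gross_zagier N W K) → Literature.NumberTheory.EllipticCurves.rank_eq_analyticRank_of_analyticRank_le_one → Literature.NumberTheory.EllipticCurves.Milne1972.bsdQuotient_baseChange_quadratic_anyModel → Literature.NumberTheory.EllipticCurves.bsdTriple_of_hasCM_of_L_one_ne_zero → ∀ (W : WeierstrassCurve ℚ) [W.IsElliptic] [W.IsGloballyMinimal] [NeZero (W.conductorNorm ℤ)], W.HasCM → Literature.NumberTheory.EllipticCurves.Rank1Residual.CMInert W 2 → W.HasSurjectiveModNGaloisRep (2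 : ℤ) → W.analyticRank = 1 → Odd W.tamagawaProduct → (∃ (K : Type) (_ : Field K) (_ : NumberField K), Literature.NumberTheory.EllipticCurves.IsImaginaryQuadratic K ∧ Odd (NumberField.discr K) ∧ NumberField.discr K ≠ -3 ∧ Literature.NumberTheory.EllipticCurves.SatisfiesHeegnerHypothesis (W.conductorNorm ℤ) K ∧ (∑ q ∈ (NumberField.discr K).natAbs.primeFactors, ((if jacobiSym W.Δ.num q = -1 then 1 else 0) + (if jacobiSym W.Δ.num q = 1 ∧ Even (W.frobeniusTrace q) then 2 else 0)) ≤ 1) ∧ Literature.NumberTheory.EllipticCurves.GrossLMS1991.prop37_2_reductionCongruence_inert (W.conductorNorm ℤ) W K ∧ ∃ (Dt : Literature.NumberTheory.EllipticCurves.ModularForms.ModularParametrizationData W (W.conductorNorm ℤ)) (β : ℤ) (ι : K →+* ℂ) (d₁ : Literature.NumberTheory.EllipticCurves.KolyvaginHeegnerData Dt β ι 1) (P₀ : (W.baseChange K).toAffine.Point) (j : K →ₐ[ℚ] ℚ_[2]), (∀ z ∈ Dt.L.lattice, ∃ w ∈ Literature.NumberTheory.EllipticCurves.ModularForms.periodLattice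 Dt.f, z = (Dt.c : ℂ) * w) ∧ Odd Dt.c ∧ WeierstrassCurve.Affine.Point.map (W' := W) (algebraMap K (Literature.NumberTheory.EllipticCurves.ringClassField K ι 1)).toRatAlgHom P₀ = d₁.derivedPoint ∧ Literature.NumberTheory.EllipticCurves.KrizLi2019.AssumptionStar W Dt K P₀ j) → Literature.NumberTheory.EllipticCurves.BSDp W 2

/-- THE CLOSER of (B′), one line (p764018). -/
theorem inertTwoStarDoorOneBitOfFactsPlus'_proof : InertTwoStarDoorOneBitOfFactsPlus' := by
  intro hmod hGZall hGZK hMilne hBF W _ _ _ hCM hin hsurj hr hT hpack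
  exact KolyvaginLowerTwo.bsdp_two_of_exists_assumptionStar_oneBit_of_printedInputs' hGZall hGZK hmod hMilne hBF W hCM hin hsurj hr hT
    hpack

end Scratch.PrintCf2CertificateAndStarDoor
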